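import Summits.RiemannHypothesis.RiemannHypothesis.Theorems.JensenLogBandCanarySeries
import Literature.NumberTheory.LFunctions.XiMoments

/-!
# E-CANARY-128 — D3 file 6/8: the piece / axis checkers and their soundness (`checkPiece = true → PieceIneq`)

RH-FREE. The Boolean functions evaluated by `native_decide` in `…CanaryCert`:
* `checkPiece box nmax rb a b L d K N J xbar U` — from the `r_n` enclosures `rb = rbArr box nmax` it encloses
  `canaryS j N z_c` (`j ≤ K`), the majorant `canaryFmaj N xbar`, the truncation allowances `canaryTrunc j N xbar`
  (via `q_K ≤ 1/2`, so `1/(1−q) ≤ 2`) and the Taylor allowance `canaryTaylorTail K J (L/2)` (via `q' ≤ 1/2`), all as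
  integers at the unit `2^U`, and decides the contract inequality `PieceIneq` of `…CanaryDefs`;
* `checkAxis box nmax rb a d N xbar U` — the same at a real point for `AxisIneq`.
MAIN RESULTS `pieceIneq_of_checkPiece`, `axisIneq_of_checkAxis`: under `RatioEncloses box xiTaylorCoeffFrom128` and
`nmax < box.length`, a `true` answer implies the contract. Nothing here bears on the truth of RH.
-/

-- D-0017: the doubled namespace is by design.
set_option linter.dupNamespace false
set_option autoImplicit false

namespace Summit.RiemannHypothesis.RiemannHypothesis.Theorems.JensenPolynomials.LogBand.Canary

open Summit.RiemannHypothesis.RiemannHypothesis.Theorems.JensenPolynomials.CoeffTable (Iv lk RatioEncloses)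
open Literature.NumberTheory.LFunctions (xiTaylorCoeff xiTaylorCoeff_pos_holds)
open Complex
open scoped Nat

/-! ## Small deciders and their meaning -/

/-- Lower bound (unit `2^U`) of `Re (w / I^d)` read off a box of `w`, for a quarter label `d < 4`. -/
def marginOf (s : ℤ × ℤ × ℤ × ℤ) (d : ℕ) : ℤ :=
  if d = 0 then s.1 else if d = 1 then s.2.2.1 else if d = 2 then -s.2.1 else -s.2.2.2

/-- `Re (w / I^d)` for the four quarter labels. -/
theorem re_div_I_pow (w : ℂ) {d : ℕ} (hd : d < 4) :
    (w / I ^ d).re = if d = 0 then w.re else if d = 1 then w.im else if d = 2 then -w.re else -w.im := by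
  interval_cases d
  · simp
  · simp [Complex.div_I]
  · simp [pow_two, Complex.div_re, Complex.normSq]
  · have h3 : I ^ 3 = -I := by rw [pow_succ, pow_two, Complex.I_mul_I]; ring
    rw [h3, div_neg, Complex.neg_re, Complex.div_I]
    simp

/-- `marginOf` is a lower bound of `Re (w / I^d)`. -/
theorem dy_marginOf_le {U : ℤ} {w : ℂ} {s : ℤ × ℤ × ℤ × ℤ} (h : BoxAt U w s) {d : ℕ} (hd : d < 4) :
    dy (marginOf s d) U ≤ (w / I ^ d).re := by
  rw [re_div_I_pow w hd]
  obtain ⟨h1, h2, h3, h4⟩ := h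
  unfold marginOf
  interval_cases d
  · simpa using h1
  · simpa using h3
  · simp only [show (2 : ℕ) = 0 ↔ False by decide, show (2 : ℕ) = 1 ↔ False by decide, if_false, if_true, dy_neg]
    linarith
  · simp only [show (3 : ℕ) = 0 ↔ False by decide, show (3 : ℕ) = 1 ↔ False by decide,
      show (3 : ℕ) = 2 ↔ False by decide, if_false, dy_neg]
    linarith

/-- Upper bound (unit `2^U`) of `‖w‖` read off a box of `w`. -/
def absUB (s : ℤ × ℤ × ℤ × ℤ) : ℤ :=
  let A := max s.1.natAbs s.2.1.natAbs
  let B := max s.2.2.1.natAbs s.2.2.2.natAbs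
  ((Nat.sqrt (A * A + B * B) + 1 : ℕ) : ℤ)

/-- A coordinate bound: `lo·2^U ≤ x ≤ hi·2^U` gives `|x| ≤ max |lo| |hi| · 2^U`. -/
theorem abs_le_dy_max {U lo hi : ℤ} {x : ℝ} (h1 : dy lo U ≤ x) (h2 : x ≤ dy hi U) :
    |x| ≤ dy ((max lo.natAbs hi.natAbs : ℕ) : ℤ) U := by
  rw [abs_le]
  constructor
  · have : dy (-((max lo.natAbs hi.natAbs : ℕ) : ℤ)) U ≤ dy lo U := dy_mono U (by omega)
    rw [dy_neg] at this; linarith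
  · exact h2.trans (dy_mono U (by omega))

/-- `absUB` bounds the modulus. -/
theorem norm_le_dy_absUB {U : ℤ} {w : ℂ} {s : ℤ × ℤ × ℤ × ℤ} (h : BoxAt U w s) : ‖w‖ ≤ dy (absUB s) U := by
  obtain ⟨h1, h2, h3, h4⟩ := h
  exact norm_le_of_abs_re_im_le (abs_le_dy_max h1 h2) (abs_le_dy_max h3 h4)

/-- `qHalfOK ρb m c`: certifies `ρ · m ≤ c` for every `ρ` below the upper end of the box `ρb` (`m, c : ℕ`). -/
def qHalfOK (ρb : FI) (m c : ℕ) : Bool :=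
  if 0 ≤ ρb.e then decide (ρb.hi * m * 2 ^ ρb.e.toNat ≤ (c : ℤ)) else decide (ρb.hi * m ≤ (c : ℤ) * 2 ^ (-ρb.e).toNat)

/-- Meaning of `qHalfOK`. -/
theorem le_of_qHalfOK {ρb : FI} {m c : ℕ} (hq : qHalfOK ρb m c = true) {ρ : ℝ} (hρ : FI.Mem ρ ρb) :
    ρ * m ≤ c := by
  have hup : ρ ≤ dy ρb.hi ρb.e := hρ.2
  have hm : (0 : ℝ) ≤ m := by positivity
  have step : ρ * m ≤ dy ρb.hi ρb.e * m := mul_le_mul_of_nonneg_right hup hm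
  unfold qHalfOK at hq
  split_ifs at hq with he
  · have hz : ρb.hi * m * 2 ^ ρb.e.toNat ≤ (c : ℤ) := of_decide_eq_true hq
    have hr : (ρb.hi : ℝ) * m * (2 : ℝ) ^ ρb.e.toNat ≤ c := by exact_mod_cast hz
    have hpow : (2 : ℝ) ^ ρb.e = (2 : ℝ) ^ ρb.e.toNat := by
      rw [← zpow_natCast]; congr 1; omega
    calc ρ * m ≤ dy ρb.hi ρb.e * m := step
      _ = (ρb.hi : ℝ) * m * (2 : ℝ) ^ ρb.e.toNat := by unfold dy; rw [hpow]; ring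
      _ ≤ c := hr
  · have hz : ρb.hi * m ≤ (c : ℤ) * 2 ^ (-ρb.e).toNat := of_decide_eq_true hq
    have hr : (ρb.hi : ℝ) * m ≤ c * (2 : ℝ) ^ (-ρb.e).toNat := by exact_mod_cast hz
    have hpos : (0 : ℝ) < (2 : ℝ) ^ (-ρb.e).toNat := by positivity
    have hpow : (2 : ℝ) ^ ρb.e * (2 : ℝ) ^ (-ρb.e).toNat = 1 := by
      rw [← zpow_natCast, ← zpow_add₀ (by norm_num : (2 : ℝ) ≠ 0)]
      have : ρb.e + (((-ρb.e).toNat : ℕ) : ℤ) = 0 := by omega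
      rw [this, zpow_zero]
    calc ρ * m ≤ dy ρb.hi ρb.e * m := step
      _ = (ρb.hi : ℝ) * m * (2 : ℝ) ^ ρb.e := by unfold dy; ring
      _ ≤ (c : ℝ) * (2 : ℝ) ^ (-ρb.e).toNat * (2 : ℝ) ^ ρb.e :=
          mul_le_mul_of_nonneg_right hr (zpow_pos (by norm_num : (0 : ℝ) < 2) _).le
      _ = c := by rw [mul_assoc, mul_comm ((2 : ℝ) ^ (-ρb.e).toNat), hpow, mul_one]

/-! ## Facts about the real objects of the contract -/

/-- `γ' = xiTaylorCoeffFrom128` is positive. -/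
theorem xiTaylorCoeffFrom128_pos (n : ℕ) : 0 < xiTaylorCoeffFrom128 n := xiTaylorCoeff_pos_holds _

/-- `canaryR n = γ'(n)/γ'(0)`. -/
theorem canaryR_eq (n : ℕ) : canaryR n = xiTaylorCoeffFrom128 n / xiTaylorCoeffFrom128 0 := by
  unfold canaryR xiTaylorCoeffFrom128; rfl

/-- `canaryR n ≥ 0`. -/
theorem canaryR_nonneg (n : ℕ) : 0 ≤ canaryR n := by
  rw [canaryR_eq]; exact (div_pos (xiTaylorCoeffFrom128_pos _) (xiTaylorCoeffFrom128_pos _)).le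

/-- `canaryRho (128 + i) = γ'(i+1)/γ'(i)`. -/
theorem canaryRho_eq (i : ℕ) : canaryRho (128 + i) = xiTaylorCoeffFrom128 (i + 1) / xiTaylorCoeffFrom128 i := by
  unfold canaryRho xiTaylorCoeffFrom128
  rw [show 128 + i + 1 = 128 + (i + 1) by ring]

/-- `canaryRho m ≥ 0`. -/
theorem canaryRho_nonneg (m : ℕ) : 0 ≤ canaryRho m :=
  (div_pos (xiTaylorCoeff_pos_holds _) (xiTaylorCoeff_pos_holds _)).le

/-- The piece centre in real coordinates. -/
theorem pieceCentre_eq (a b : ℤ) : pieceCentre a b = (((a : ℝ) / 2 : ℝ) : ℂ) + (((b : ℝ) / 2 : ℝ) : ℂ) * I := by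
  unfold pieceCentre; push_cast; ring

/-- A doubled real abscissa: `pieceCentre c 0 = c/2`. -/
theorem pieceCentre_real (c : ℤ) : pieceCentre c 0 = (((c : ℝ) / 2 : ℝ) : ℂ) := by
  rw [pieceCentre_eq]; push_cast; ring

/-- `‖pieceCentre a b‖ ≤ xbar` from the integer test `a² + b² ≤ 4·xbar²`. -/
theorem norm_pieceCentre_le {a b : ℤ} {xbar : ℕ} (h : a * a + b * b ≤ 4 * (xbar : ℤ) * xbar) :
    ‖pieceCentre a b‖ ≤ (xbar : ℝ) := by
  have hsq : ‖pieceCentre a b‖ ^ 2 ≤ (xbar : ℝ) ^ 2 := by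
    rw [pieceCentre_eq, Complex.sq_norm, Complex.normSq_add_mul_I]
    have : (a : ℝ) * a + b * b ≤ 4 * (xbar : ℝ) * xbar := by exact_mod_cast h
    nlinarith
  exact (abs_le_of_sq_le_sq' hsq (by positivity)).2

/-- Powers of a real abscissa are real: `(pieceCentre c 0)^m/m! = ((c/2)^m/m! : ℝ)`. -/
theorem pieceCentre_real_pow_div (c : ℤ) (m : ℕ) :
    pieceCentre c 0 ^ m / (m ! : ℂ) = ((((c : ℝ) / 2) ^ m / (m ! : ℝ) : ℝ) : ℂ) := by
  rw [pieceCentre_real]; push_cast; ring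

/-- `canaryS` in the shape of `sumS_mem`. -/
theorem canaryS_eq (j N : ℕ) (z : ℂ) :
    canaryS j N z = ∑ k ∈ Finset.range (N - j + 1), (canaryR (k + j) : ℂ) * (z ^ k / (k ! : ℂ)) := by
  unfold canaryS
  refine Finset.sum_congr rfl fun k _ => ?_
  rw [mul_div_assoc]

/-! ## The checker -/

/-- Upper bound (unit `2^U`) of `ρ · Re w` for `ρ` in a nonnegative real interval and `w` in a box. -/
def prodUB (r : FI) (x : CI) (U : ℤ) : ℤ :=
  let t := CI.mulFIpos r x
  toUnitCeil t.rhi t.e U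

/-- Meaning of `prodUB`. -/
theorem le_dy_prodUB {ρ : ℝ} {w : ℂ} {r : FI} {x : CI} (h0 : 0 ≤ r.lo) (hρ : FI.Mem ρ r) (hw : CI.Mem w x) (U : ℤ) :
    ρ * w.re ≤ dy (prodUB r x U) U := by
  have hm := CI.mulFIpos_mem h0 hρ hw
  have : ((ρ : ℂ) * w).re = ρ * w.re := by simp
  rw [← this]
  exact hm.2.1.trans (dy_le_toUnitCeil _ _ _)

/-- The deviation term of order `j`: `⌈(‖S_j‖⁺ + 2·TR⁺)·L^j / (2^j·j!)⌉` at unit `2^U`. -/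
def devTerm (rb : Array FI) (pz px : Array CI) (N L : ℕ) (U : ℤ) (j : ℕ) : ℤ :=
  divCeil ((absUB (sumS rb pz j N U) + 2 * prodUB (getFI rb (N + 1)) (getCI px (N - j + 1)) U) * ((L ^ j : ℕ) : ℤ))
    (2 ^ j * j !)

/-- **The piece checker** (see the file header). `box`: the ratio box; `nmax`: how far `rb = rbArr box nmax` reaches;
piece centre `(a + b·I)/2`, length `L`, label `d`, Taylor order `K`, truncation index `N`, tail length `J`, radius bound
`xbar`, accumulator unit `2^U` (and `2^V` for the Taylor allowance, which is multiplied by the large majorant). -/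
def checkPiece (box : List Iv) (nmax : ℕ) (rb : Array FI) (a b : ℤ) (L d K N J xbar : ℕ) (U V : ℤ) : Bool :=
  let pz := pzArr a b N
  let px := pzArr (2 * (xbar : ℤ)) 0 (N + 1)
  let ph := pzArr (L : ℤ) 0 (K + J + 1)
  let M := marginOf (sumS rb pz 0 N U) d
  let tr0 := 2 * prodUB (getFI rb (N + 1)) (getCI px (N + 1)) U
  let Fx := (sumS rb px 0 N U).2.1 + tr0
  let TT := (sumSAux rb ph 0 V J (K + 1) 0 0 0 0).2.1 + 2 * prodUB (getFI rb (K + J + 1)) (getCI ph (K + J + 1)) V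
  let dev := ∑ j ∈ Finset.Icc 1 K, devTerm rb pz px N L U j
  let prod := toUnitCeil (Fx * TT) (U + V) U
  decide (K + 1 ≤ N) && decide (N + 1 ≤ nmax) && decide (K + J + 1 ≤ nmax) && decide (d < 4) &&
    decide (a * a + b * b ≤ 4 * (xbar : ℤ) * xbar) &&
    qHalfOK (rhoFI (lk box (N + 1))) (2 * xbar) (N - K + 2) &&
    qHalfOK (rhoFI (lk box (K + J + 1))) L (K + J + 2) &&
    decide (dev + prod < M - tr0)

/-- **The axis checker**: the sign of `canaryF` at the real point `a/2` (label `d ∈ {0, 2}` in practice). -/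
def checkAxis (box : List Iv) (nmax : ℕ) (rb : Array FI) (a : ℤ) (d N xbar : ℕ) (U : ℤ) : Bool :=
  let pz := pzArr a 0 N
  let px := pzArr (2 * (xbar : ℤ)) 0 (N + 1)
  let M := marginOf (sumS rb pz 0 N U) d
  let tr0 := 2 * prodUB (getFI rb (N + 1)) (getCI px (N + 1)) U
  decide (1 ≤ N) && decide (N + 1 ≤ nmax) && decide (d < 4) && decide (a * a ≤ 4 * (xbar : ℤ) * xbar) &&
    qHalfOK (rhoFI (lk box (N + 1))) (2 * xbar) (N + 2) && decide (tr0 < M)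

end Summit.RiemannHypothesis.RiemannHypothesis.Theorems.JensenPolynomials.LogBand.Canary
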